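import Literature.Topology.FourManifolds.ImmersionCriterion
import Literature.Topology.FourManifolds.DehnSurgeryTubularNbhdProofs
import Mathlib.Analysis.Calculus.ContDiff.WithLp
import Mathlib.Analysis.SpecialFunctions.Trigonometric.ArctanDeriv
import Mathlib.Analysis.SpecialFunctions.Trigonometric.Inverse
import Mathlib.Analysis.InnerProductSpace.Calculus
import Mathlib.Geometry.Manifold.Instances.Sphere
import HarnessLib

/-!
# The conformal embedding of the cylinder `ℝ × Sⁿ` into the sphere `Sⁿ⁺¹`

Topic `Literature/Topology/FourManifolds`; infrastructure for the fact seat of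
`Literature.Topology.FourManifolds.BudneyGabai2019_thm_3_13` (`NonSeparatingSpheres.lean`;
R. Budney, D. Gabai, *Knotted 3-balls in `S⁴`*, arXiv:1912.09029, Thm. 3.13: `Diff(S¹ × Sⁿ)` is
transitive on non-separating `n`-spheres).  The degree count for the dual circle of a
non-separating sphere `K ⊂ S¹ × Sⁿ` (proof of Thm. 3.13, p. 22) takes place in the infinite
cyclic cover `ℝ × Sⁿ` (`NonSeparatingSpheresCover.lean`), where the lifted sphere `K̃` separates;
the separation is read off in `Sⁿ⁺¹ ⊃ ℝ × Sⁿ` from the tree's Jordan–Brouwer theorem for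
smooth hypersurface spheres (`SphereHypersurfaceSides.lean`).  This file provides the embedding
`ℝ × Sⁿ ↪ Sⁿ⁺¹` used for that transfer, in latitude–longitude form:

* `CylinderToSphere.map n : ℝ × Sⁿ → Sⁿ⁺¹`, `(t, p) ↦ (cos θ · p, sin θ)` with the latitude
  `θ = arctan t ∈ (-π/2, π/2)` (so `t → ±∞` are the two poles `(0, ±1)`);
* it is `C^∞` for the product model `𝓘(ℝ, ℝ).prod (𝓡 n)` (`contMDiff_map`), injective
  (`injective_map`), with everywhere injective differential (`injective_mfderiv_map`) — the
  latter through the explicit left inverse `unmap n : ℝⁿ⁺² → ℝ × ℝⁿ⁺¹`,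
  `z ↦ (z_last / ‖z_init‖, z_init / ‖z_init‖)`, smooth off the polar axis, whose composite with
  `map n` is `(t, p) ↦ (t, p)` into `ℝ × ℝⁿ⁺¹`, an immersion by Mathlib's
  `mfderiv_coe_sphere_injective`;
* hence `map n ∘ f` is a smooth embedding `Sᵐ → Sⁿ⁺¹` for every smooth embedding
  `f : Sᵐ → ℝ × Sⁿ` of a sphere (`isSmoothEmbedding_map_comp`, by the tree's criterion
  `isSmoothEmbedding_of_injective_of_injective_mfderiv`);
* the last coordinate of `map n (t, p)` is `sin (arctan t)` (`coe_map_apply_last`), the image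
  misses the poles (`init_coe_map_ne_zero`), and `map n (t, p)` tends to the north (south) pole
  uniformly in `p` as `t → +∞` (`-∞`) (`dist_map_northPole_lt`, `dist_map_southPole_lt`).

Everything here is proved; the only definitions are the explicit coordinate maps.

## References

* R. Budney, D. Gabai, *Knotted 3-balls in `S⁴`*, arXiv:1912.09029 (v2), §3, proof of Thm. 3.13
  (p. 22). [BudneyGabai2019]
* M. W. Hirsch, *Differential Topology*, GTM 33 (1976), Ch. 1 §1 (coordinates on spheres).
  [HirschDT1976]
-/

noncomputable section

open scoped Manifold ContDiff Topology Real
open Set Function Metric Module Filter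

namespace Literature.Topology.FourManifolds

/-- Local notation: `𝔼 n` is the model Euclidean space `EuclideanSpace ℝ (Fin n)`. -/
local notation "𝔼 " n:arg => EuclideanSpace ℝ (Fin n)

/-- Local notation: `𝕊 n` is the unit sphere in `EuclideanSpace ℝ (Fin (n + 1))`. -/
local notation "𝕊 " n:arg => (Metric.sphere (0 : EuclideanSpace ℝ (Fin (n + 1))) 1)

/-- `finrank ℝ ℝⁿ⁺¹ = n + 1` as a `Fact` (for Mathlib's sphere API). [folklore] -/
private theorem fact_finrank_euclideanSpace_succ' (n : ℕ) :
    Fact (finrank ℝ (𝔼 (n + 1)) = n + 1) :=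
  ⟨finrank_euclideanSpace_fin⟩

attribute [local instance] fact_finrank_euclideanSpace_succ'

namespace CylinderToSphere

variable (n : ℕ)

/-! ### The coordinate map `ℝ × ℝⁿ⁺¹ → ℝⁿ⁺²` -/

/-- The vector `(cos (arctan t) · v, sin (arctan t)) ∈ ℝⁿ⁺²` (first `n + 1` coordinates, then the
last one). [folklore] -/
def vec (q : ℝ × 𝔼 (n + 1)) : 𝔼 (n + 1 + 1) :=
  WithLp.toLp 2 fun i ↦ Fin.lastCases (motive := fun _ ↦ ℝ) (Real.sin (Real.arctan q.1))
    (fun j ↦ Real.cos (Real.arctan q.1) * q.2 j) i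

/-- The last coordinate of `vec`. [folklore] -/
@[simp] theorem vec_apply_last (q : ℝ × 𝔼 (n + 1)) :
    vec n q (Fin.last (n + 1)) = Real.sin (Real.arctan q.1) := by
  simp [vec]

/-- The first `n + 1` coordinates of `vec`. [folklore] -/
@[simp] theorem vec_apply_castSucc (q : ℝ × 𝔼 (n + 1)) (j : Fin (n + 1)) :
    vec n q (Fin.castSucc j) = Real.cos (Real.arctan q.1) * q.2 j := by
  simp [vec]

/-- `vec` is smooth. [folklore] -/
theorem contDiff_vec : ContDiff ℝ ∞ (vec n) := by
  rw [contDiff_euclidean]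
  intro i
  induction i using Fin.lastCases with
  | last =>
    simp only [vec_apply_last]
    exact Real.contDiff_sin.comp (Real.contDiff_arctan.comp contDiff_fst)
  | cast j =>
    simp only [vec_apply_castSucc]
    exact (Real.contDiff_cos.comp (Real.contDiff_arctan.comp contDiff_fst)).mul
      ((contDiff_piLp_apply (𝕜 := ℝ) (p := 2) (i := j)).comp contDiff_snd)

/-- `‖vec (t, p)‖ = 1` for a unit vector `p`. [folklore] -/
theorem norm_vec (t : ℝ) (p : 𝕊 n) : ‖vec n (t, (p : 𝔼 (n + 1)))‖ = 1 := by
  have hp : ‖(p : 𝔼 (n + 1))‖ = 1 := by simp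
  have hp2 : ∑ j, ((p : 𝔼 (n + 1)) j) ^ 2 = 1 := by
    rw [← EuclideanSpace.real_norm_sq_eq, hp, one_pow]
  have h1 : ‖vec n (t, (p : 𝔼 (n + 1)))‖ ^ 2 = 1 := by
    rw [EuclideanSpace.real_norm_sq_eq, Fin.sum_univ_castSucc]
    simp only [vec_apply_last, vec_apply_castSucc]
    calc ∑ j, (Real.cos (Real.arctan t) * (p : 𝔼 (n + 1)) j) ^ 2 + Real.sin (Real.arctan t) ^ 2
        = Real.cos (Real.arctan t) ^ 2 * ∑ j, ((p : 𝔼 (n + 1)) j) ^ 2 +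
            Real.sin (Real.arctan t) ^ 2 := by
          rw [Finset.mul_sum]
          congr 1
          exact Finset.sum_congr rfl fun j _ ↦ by ring
      _ = 1 := by rw [hp2, mul_one, Real.cos_sq_add_sin_sq]
  exact (pow_left_inj₀ (norm_nonneg _) zero_le_one two_ne_zero).1 (by rw [h1, one_pow])

/-! ### The map `ℝ × Sⁿ → Sⁿ⁺¹` -/

/-- **The cylinder-to-sphere map** `(t, p) ↦ (cos θ · p, sin θ)`, `θ = arctan t`: a smooth
embedding of `ℝ × Sⁿ` onto the complement of the two poles of `Sⁿ⁺¹`. [folklore] -/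
def map (q : ℝ × 𝕊 n) : 𝕊 (n + 1) :=
  ⟨vec n (q.1, (q.2 : 𝔼 (n + 1))), by
    rw [mem_sphere_zero_iff_norm]
    exact norm_vec n q.1 q.2⟩

/-- The underlying vector of `map n q`. [folklore] -/
@[simp] theorem coe_map (q : ℝ × 𝕊 n) :
    (map n q : 𝔼 (n + 1 + 1)) = vec n (q.1, (q.2 : 𝔼 (n + 1))) := rfl

/-- The last coordinate of `map n (t, p)` is `sin (arctan t)`. [folklore] -/
theorem coe_map_apply_last (q : ℝ × 𝕊 n) :
    (map n q : 𝔼 (n + 1 + 1)) (Fin.last (n + 1)) = Real.sin (Real.arctan q.1) := by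
  simp

/-- `map n` is smooth for the product model of `ℝ × Sⁿ`. [folklore] -/
theorem contMDiff_map : ContMDiff (𝓘(ℝ, ℝ).prod (𝓡 n)) (𝓡 (n + 1)) ∞ (map n) := by
  have h1 : ContMDiff (𝓘(ℝ, ℝ).prod (𝓡 n)) 𝓘(ℝ, 𝔼 (n + 1 + 1)) ∞
      (fun q : ℝ × 𝕊 n ↦ vec n (q.1, (q.2 : 𝔼 (n + 1)))) :=
    (contDiff_vec n).contMDiff.comp
      (contMDiff_fst.prodMk_space (contMDiff_coe_sphere.comp contMDiff_snd))
  exact h1.codRestrict_sphere _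

/-- `map n` is continuous. [folklore] -/
theorem continuous_map : Continuous (map n) := (contMDiff_map n).continuous

/-- `map n` is injective (the latitude `sin (arctan t)` determines `t`; `cos (arctan t) > 0`).
[folklore] -/
theorem injective_map : Injective (map n) := by
  rintro ⟨t, p⟩ ⟨t', p'⟩ h
  have hv : vec n (t, (p : 𝔼 (n + 1))) = vec n (t', (p' : 𝔼 (n + 1))) := congrArg Subtype.val h
  have hlast := congrArg (fun v : 𝔼 (n + 1 + 1) ↦ v (Fin.last (n + 1))) hv
  simp only [vec_apply_last] at hlast
  have ht : t = t' := by
    have := Real.injOn_sin ⟨(Real.neg_pi_div_two_lt_arctan t).le, (Real.arctan_lt_pi_div_two t).le⟩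
      ⟨(Real.neg_pi_div_two_lt_arctan t').le, (Real.arctan_lt_pi_div_two t').le⟩ hlast
    exact Real.arctan_strictMono.injective this
  subst ht
  have hcos : Real.cos (Real.arctan t) ≠ 0 := (Real.cos_arctan_pos t).ne'
  have hp : (p : 𝔼 (n + 1)) = p' := by
    ext j
    have := congrArg (fun v : 𝔼 (n + 1 + 1) ↦ v (Fin.castSucc j)) hv
    simp only [vec_apply_castSucc] at this
    exact mul_left_cancel₀ hcos this
  rw [Subtype.ext hp]

/-! ### The left inverse `z ↦ (z_last / ‖z_init‖, z_init / ‖z_init‖)` -/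

/-- The first `n + 1` coordinates of a vector of `ℝⁿ⁺²`. [folklore] -/
def init (z : 𝔼 (n + 1 + 1)) : 𝔼 (n + 1) :=
  WithLp.toLp 2 fun j ↦ z (Fin.castSucc j)

/-- Coordinates of `init`. [folklore] -/
@[simp] theorem init_apply (z : 𝔼 (n + 1 + 1)) (j : Fin (n + 1)) :
    init n z j = z (Fin.castSucc j) := by
  simp [init]

/-- `init` is smooth (it is linear). [folklore] -/
theorem contDiff_init : ContDiff ℝ ∞ (init n) := by
  rw [contDiff_euclidean]
  intro j
  simp only [init_apply]
  exact contDiff_piLp_apply (𝕜 := ℝ) (p := 2) (i := Fin.castSucc j)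

/-- `init (vec (t, v)) = cos (arctan t) • v`. [folklore] -/
theorem init_vec (t : ℝ) (v : 𝔼 (n + 1)) :
    init n (vec n (t, v)) = Real.cos (Real.arctan t) • v := by
  ext j
  simp [init_apply, vec_apply_castSucc]

/-- The image of `map n` misses the polar axis: `init (map n q) ≠ 0`. [folklore] -/
theorem init_coe_map_ne_zero (q : ℝ × 𝕊 n) : init n (map n q : 𝔼 (n + 1 + 1)) ≠ 0 := by
  rw [coe_map, init_vec]
  exact smul_ne_zero (Real.cos_arctan_pos q.1).ne' (ne_zero_of_mem_unit_sphere q.2)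

/-- `‖init (map n (t, p))‖ = cos (arctan t)`. [folklore] -/
theorem norm_init_coe_map (q : ℝ × 𝕊 n) :
    ‖init n (map n q : 𝔼 (n + 1 + 1))‖ = Real.cos (Real.arctan q.1) := by
  rw [coe_map, init_vec, norm_smul, Real.norm_eq_abs, abs_of_pos (Real.cos_arctan_pos q.1),
    norm_eq_of_mem_sphere q.2, mul_one]

/-- The first component of the left inverse: `z ↦ z_last / ‖z_init‖`. [folklore] -/
def unmapFst (z : 𝔼 (n + 1 + 1)) : ℝ := z (Fin.last (n + 1)) / ‖init n z‖

/-- The second component of the left inverse: `z ↦ z_init / ‖z_init‖`. [folklore] -/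
def unmapSnd (z : 𝔼 (n + 1 + 1)) : 𝔼 (n + 1) := ‖init n z‖⁻¹ • init n z

/-- `unmapFst (map n (t, p)) = t` (as `sin θ / cos θ = tan θ = t` for `θ = arctan t`).
[folklore] -/
theorem unmapFst_coe_map (q : ℝ × 𝕊 n) : unmapFst n (map n q : 𝔼 (n + 1 + 1)) = q.1 := by
  rw [unmapFst, norm_init_coe_map, coe_map_apply_last, ← Real.tan_eq_sin_div_cos, Real.tan_arctan]

/-- `unmapSnd (map n (t, p)) = p`. [folklore] -/
theorem unmapSnd_coe_map (q : ℝ × 𝕊 n) :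
    unmapSnd n (map n q : 𝔼 (n + 1 + 1)) = (q.2 : 𝔼 (n + 1)) := by
  rw [unmapSnd, norm_init_coe_map, coe_map, init_vec, smul_smul,
    inv_mul_cancel₀ (Real.cos_arctan_pos q.1).ne', one_smul]

/-- `unmapFst` is smooth off the polar axis. [folklore] -/
theorem contDiffAt_unmapFst {z : 𝔼 (n + 1 + 1)} (hz : init n z ≠ 0) :
    ContDiffAt ℝ ∞ (unmapFst n) z := by
  have h1 : ContDiffAt ℝ ∞ (fun z ↦ ‖init n z‖) z :=
    (contDiffAt_norm ℝ hz).comp z (contDiff_init n).contDiffAt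
  exact ((contDiff_piLp_apply (𝕜 := ℝ) (p := 2) (i := Fin.last (n + 1))).contDiffAt).div h1
    (norm_ne_zero_iff.2 hz)

/-- `unmapSnd` is smooth off the polar axis. [folklore] -/
theorem contDiffAt_unmapSnd {z : 𝔼 (n + 1 + 1)} (hz : init n z ≠ 0) :
    ContDiffAt ℝ ∞ (unmapSnd n) z := by
  have h1 : ContDiffAt ℝ ∞ (fun z ↦ ‖init n z‖) z :=
    (contDiffAt_norm ℝ hz).comp z (contDiff_init n).contDiffAt
  exact (h1.inv (norm_ne_zero_iff.2 hz)).smul (contDiff_init n).contDiffAt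

/-! ### `map n` is an immersion -/

/-- The map `(t, p) ↦ (t, p) : ℝ × Sⁿ → ℝ × ℝⁿ⁺¹` has injective differential (its second
component is the inclusion of the sphere, Mathlib's `mfderiv_coe_sphere_injective`).
[folklore] -/
theorem injective_mfderiv_prodCoe (q : ℝ × 𝕊 n) :
    Injective (mfderiv (𝓘(ℝ, ℝ).prod (𝓡 n)) (𝓘(ℝ, ℝ).prod 𝓘(ℝ, 𝔼 (n + 1)))
      (fun q : ℝ × 𝕊 n ↦ (q.1, (q.2 : 𝔼 (n + 1)))) q) := by
  have hf : MDifferentiableAt (𝓘(ℝ, ℝ).prod (𝓡 n)) 𝓘(ℝ, ℝ) (fun q : ℝ × 𝕊 n ↦ q.1) q :=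
    mdifferentiableAt_fst
  have hg : MDifferentiableAt (𝓘(ℝ, ℝ).prod (𝓡 n)) 𝓘(ℝ, 𝔼 (n + 1))
      (fun q : ℝ × 𝕊 n ↦ (q.2 : 𝔼 (n + 1))) q :=
    ((contMDiff_coe_sphere (m := ∞)).comp contMDiff_snd).mdifferentiableAt (by simp)
  rw [mfderiv_prodMk hf hg]
  have hsnd : mfderiv (𝓘(ℝ, ℝ).prod (𝓡 n)) 𝓘(ℝ, 𝔼 (n + 1))
      (fun q : ℝ × 𝕊 n ↦ (q.2 : 𝔼 (n + 1))) q =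
      (mfderiv (𝓡 n) 𝓘(ℝ, 𝔼 (n + 1)) (fun p : 𝕊 n ↦ (p : 𝔼 (n + 1))) q.2).comp
        (mfderiv (𝓘(ℝ, ℝ).prod (𝓡 n)) (𝓡 n) (fun q : ℝ × 𝕊 n ↦ q.2) q) :=
    mfderiv_comp q ((contMDiff_coe_sphere (m := ∞)).mdifferentiableAt (by simp))
      mdifferentiableAt_snd
  have e1 : mfderiv (𝓘(ℝ, ℝ).prod (𝓡 n)) 𝓘(ℝ, ℝ) (fun q : ℝ × 𝕊 n ↦ q.1) q =
      ContinuousLinearMap.fst ℝ (TangentSpace 𝓘(ℝ, ℝ) q.1) (TangentSpace (𝓡 n) q.2) :=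
    mfderiv_fst
  have e2 : mfderiv (𝓘(ℝ, ℝ).prod (𝓡 n)) (𝓡 n) (fun q : ℝ × 𝕊 n ↦ q.2) q =
      ContinuousLinearMap.snd ℝ (TangentSpace 𝓘(ℝ, ℝ) q.1) (TangentSpace (𝓡 n) q.2) :=
    mfderiv_snd
  intro v w hvw
  have h1 : mfderiv (𝓘(ℝ, ℝ).prod (𝓡 n)) 𝓘(ℝ, ℝ) (fun q : ℝ × 𝕊 n ↦ q.1) q v =
      mfderiv (𝓘(ℝ, ℝ).prod (𝓡 n)) 𝓘(ℝ, ℝ) (fun q : ℝ × 𝕊 n ↦ q.1) q w :=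
    congrArg Prod.fst hvw
  have h2 : mfderiv (𝓘(ℝ, ℝ).prod (𝓡 n)) 𝓘(ℝ, 𝔼 (n + 1))
      (fun q : ℝ × 𝕊 n ↦ (q.2 : 𝔼 (n + 1))) q v =
      mfderiv (𝓘(ℝ, ℝ).prod (𝓡 n)) 𝓘(ℝ, 𝔼 (n + 1))
        (fun q : ℝ × 𝕊 n ↦ (q.2 : 𝔼 (n + 1))) q w :=
    congrArg Prod.snd hvw
  rw [e1] at h1
  rw [hsnd, e2] at h2
  have h1' : v.1 = w.1 := h1
  have h2' : (mfderiv (𝓡 n) 𝓘(ℝ, 𝔼 (n + 1)) (fun p : 𝕊 n ↦ (p : 𝔼 (n + 1))) q.2) v.2 =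
      (mfderiv (𝓡 n) 𝓘(ℝ, 𝔼 (n + 1)) (fun p : 𝕊 n ↦ (p : 𝔼 (n + 1))) q.2) w.2 := h2
  exact Prod.ext h1' (mfderiv_coe_sphere_injective q.2 h2')

/-- **`map n` is an immersion**: its differential is injective at every point (the left inverse
`(unmapFst, unmapSnd)` is smooth near `map n q` and its composite with `map n` is the immersion
`(t, p) ↦ (t, p)` of `injective_mfderiv_prodCoe`). [folklore] -/
theorem injective_mfderiv_map (q : ℝ × 𝕊 n) :
    Injective (mfderiv (𝓘(ℝ, ℝ).prod (𝓡 n)) (𝓡 (n + 1)) (map n) q) := by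
  set κ : 𝕊 (n + 1) → ℝ × 𝔼 (n + 1) :=
    fun z ↦ (unmapFst n (z : 𝔼 (n + 1 + 1)), unmapSnd n (z : 𝔼 (n + 1 + 1))) with hκ
  have hcomp : κ ∘ map n = fun q : ℝ × 𝕊 n ↦ (q.1, (q.2 : 𝔼 (n + 1))) :=
    funext fun q ↦ Prod.ext (unmapFst_coe_map n q) (unmapSnd_coe_map n q)
  have hz : init n (map n q : 𝔼 (n + 1 + 1)) ≠ 0 := init_coe_map_ne_zero n q
  have hκ1 : ContMDiffAt (𝓡 (n + 1)) 𝓘(ℝ, ℝ) ∞ (fun z : 𝕊 (n + 1) ↦ unmapFst n (z : 𝔼 (n + 1 + 1)))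
      (map n q) :=
    (contDiffAt_unmapFst n hz).comp_contMDiffAt contMDiff_coe_sphere.contMDiffAt
  have hκ2 : ContMDiffAt (𝓡 (n + 1)) 𝓘(ℝ, 𝔼 (n + 1)) ∞
      (fun z : 𝕊 (n + 1) ↦ unmapSnd n (z : 𝔼 (n + 1 + 1))) (map n q) :=
    (contDiffAt_unmapSnd n hz).comp_contMDiffAt contMDiff_coe_sphere.contMDiffAt
  have hκs : ContMDiffAt (𝓡 (n + 1)) (𝓘(ℝ, ℝ).prod 𝓘(ℝ, 𝔼 (n + 1))) ∞ κ (map n q) :=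
    hκ1.prodMk hκ2
  have hchain : mfderiv (𝓘(ℝ, ℝ).prod (𝓡 n)) (𝓘(ℝ, ℝ).prod 𝓘(ℝ, 𝔼 (n + 1)))
      (fun q : ℝ × 𝕊 n ↦ (q.1, (q.2 : 𝔼 (n + 1)))) q =
      (mfderiv (𝓡 (n + 1)) (𝓘(ℝ, ℝ).prod 𝓘(ℝ, 𝔼 (n + 1))) κ (map n q)).comp
        (mfderiv (𝓘(ℝ, ℝ).prod (𝓡 n)) (𝓡 (n + 1)) (map n) q) := by
    rw [← hcomp]
    exact mfderiv_comp q (hκs.mdifferentiableAt (by simp))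
      ((contMDiff_map n q).mdifferentiableAt (by simp))
  have hinj := injective_mfderiv_prodCoe n q
  rw [hchain] at hinj
  have key : Injective
      (⇑(mfderiv (𝓡 (n + 1)) (𝓘(ℝ, ℝ).prod 𝓘(ℝ, 𝔼 (n + 1))) κ (map n q)) ∘
        ⇑(mfderiv (𝓘(ℝ, ℝ).prod (𝓡 n)) (𝓡 (n + 1)) (map n) q)) := hinj
  exact key.of_comp

/-- **A smoothly embedded sphere of the cylinder is a smoothly embedded sphere of `Sⁿ⁺¹`**:
for a smooth embedding `f : Sᵐ → ℝ × Sⁿ`, the composite `map n ∘ f : Sᵐ → Sⁿ⁺¹` is a smooth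
embedding (injective with injective differential, on a compact manifold: the tree's criterion
`isSmoothEmbedding_of_injective_of_injective_mfderiv`, Hirsch Ch. 1 §3, Thm. 3.1). [folklore] -/
theorem isSmoothEmbedding_map_comp {m : ℕ} {f : 𝕊 m → ℝ × 𝕊 n}
    (hf : Manifold.IsSmoothEmbedding (𝓡 m) (𝓘(ℝ, ℝ).prod (𝓡 n)) ∞ f) :
    Manifold.IsSmoothEmbedding (𝓡 m) (𝓡 (n + 1)) ∞ (map n ∘ f) := by
  refine isSmoothEmbedding_of_injective_of_injective_mfderiv ((contMDiff_map n).comp hf.contMDiff)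
    (by simp) ((injective_map n).comp hf.isEmbedding.injective) fun x ↦ ?_
  rw [mfderiv_comp x ((contMDiff_map n _).mdifferentiableAt (by simp))
    (hf.contMDiff.mdifferentiableAt (by simp))]
  have key : Injective (⇑(mfderiv (𝓘(ℝ, ℝ).prod (𝓡 n)) (𝓡 (n + 1)) (map n) (f x)) ∘
      ⇑(mfderiv (𝓡 m) (𝓘(ℝ, ℝ).prod (𝓡 n)) f x)) :=
    (injective_mfderiv_map n (f x)).comp (mfderiv_injective_of_isImmersion hf.isImmersion (by simp) x)
  exact key

/-! ### The poles and the ends of the cylinder -/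

/-- The north pole `(0, …, 0, 1)` of `Sⁿ⁺¹`. [folklore] -/
def northPole : 𝕊 (n + 1) :=
  ⟨EuclideanSpace.single (Fin.last (n + 1)) 1, by simp [PiLp.norm_single]⟩

/-- The south pole `(0, …, 0, -1)` of `Sⁿ⁺¹`. [folklore] -/
def southPole : 𝕊 (n + 1) :=
  ⟨EuclideanSpace.single (Fin.last (n + 1)) (-1), by simp [PiLp.norm_single]⟩

/-- Coordinates of the difference `map n q - northPole`. [folklore] -/
theorem coe_map_sub_northPole_apply_castSucc (q : ℝ × 𝕊 n) (j : Fin (n + 1)) :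
    ((map n q : 𝔼 (n + 1 + 1)) - (northPole n : 𝔼 (n + 1 + 1))) (Fin.castSucc j) =
      Real.cos (Real.arctan q.1) * (q.2 : 𝔼 (n + 1)) j := by
  simp [northPole, (Fin.castSucc_lt_last j).ne]

/-- The last coordinate of the difference `map n q - northPole`. [folklore] -/
theorem coe_map_sub_northPole_apply_last (q : ℝ × 𝕊 n) :
    ((map n q : 𝔼 (n + 1 + 1)) - (northPole n : 𝔼 (n + 1 + 1))) (Fin.last (n + 1)) =
      Real.sin (Real.arctan q.1) - 1 := by
  simp [northPole]

/-- Coordinates of the difference `map n q - southPole`. [folklore] -/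
theorem coe_map_sub_southPole_apply_castSucc (q : ℝ × 𝕊 n) (j : Fin (n + 1)) :
    ((map n q : 𝔼 (n + 1 + 1)) - (southPole n : 𝔼 (n + 1 + 1))) (Fin.castSucc j) =
      Real.cos (Real.arctan q.1) * (q.2 : 𝔼 (n + 1)) j := by
  simp [southPole, (Fin.castSucc_lt_last j).ne]

/-- The last coordinate of the difference `map n q - southPole`. [folklore] -/
theorem coe_map_sub_southPole_apply_last (q : ℝ × 𝕊 n) :
    ((map n q : 𝔼 (n + 1 + 1)) - (southPole n : 𝔼 (n + 1 + 1))) (Fin.last (n + 1)) =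
      Real.sin (Real.arctan q.1) + 1 := by
  simp [southPole]

/-- The squared distance from `map n (t, p)` to the north pole is `2 - 2 sin (arctan t)`.
[folklore] -/
theorem dist_map_northPole_sq (q : ℝ × 𝕊 n) :
    dist (map n q) (northPole n) ^ 2 = 2 - 2 * Real.sin (Real.arctan q.1) := by
  rw [Subtype.dist_eq, dist_eq_norm, EuclideanSpace.real_norm_sq_eq, Fin.sum_univ_castSucc,
    coe_map_sub_northPole_apply_last,
    Finset.sum_congr rfl fun j _ ↦ by rw [coe_map_sub_northPole_apply_castSucc]]
  have hp2 : ∑ j, ((q.2 : 𝔼 (n + 1)) j) ^ 2 = 1 := by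
    rw [← EuclideanSpace.real_norm_sq_eq, norm_eq_of_mem_sphere q.2, one_pow]
  calc ∑ j, (Real.cos (Real.arctan q.1) * (q.2 : 𝔼 (n + 1)) j) ^ 2 +
        (Real.sin (Real.arctan q.1) - 1) ^ 2
      = Real.cos (Real.arctan q.1) ^ 2 * ∑ j, ((q.2 : 𝔼 (n + 1)) j) ^ 2 +
          (Real.sin (Real.arctan q.1) - 1) ^ 2 := by
        rw [Finset.mul_sum]
        congr 1
        exact Finset.sum_congr rfl fun j _ ↦ by ring
    _ = 2 - 2 * Real.sin (Real.arctan q.1) := by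
        rw [hp2, mul_one]
        nlinarith [Real.cos_sq_add_sin_sq (Real.arctan q.1)]

/-- The squared distance from `map n (t, p)` to the south pole is `2 + 2 sin (arctan t)`.
[folklore] -/
theorem dist_map_southPole_sq (q : ℝ × 𝕊 n) :
    dist (map n q) (southPole n) ^ 2 = 2 + 2 * Real.sin (Real.arctan q.1) := by
  rw [Subtype.dist_eq, dist_eq_norm, EuclideanSpace.real_norm_sq_eq, Fin.sum_univ_castSucc,
    coe_map_sub_southPole_apply_last,
    Finset.sum_congr rfl fun j _ ↦ by rw [coe_map_sub_southPole_apply_castSucc]]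
  have hp2 : ∑ j, ((q.2 : 𝔼 (n + 1)) j) ^ 2 = 1 := by
    rw [← EuclideanSpace.real_norm_sq_eq, norm_eq_of_mem_sphere q.2, one_pow]
  calc ∑ j, (Real.cos (Real.arctan q.1) * (q.2 : 𝔼 (n + 1)) j) ^ 2 +
        (Real.sin (Real.arctan q.1) + 1) ^ 2
      = Real.cos (Real.arctan q.1) ^ 2 * ∑ j, ((q.2 : 𝔼 (n + 1)) j) ^ 2 +
          (Real.sin (Real.arctan q.1) + 1) ^ 2 := by
        rw [Finset.mul_sum]
        congr 1
        exact Finset.sum_congr rfl fun j _ ↦ by ring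
    _ = 2 + 2 * Real.sin (Real.arctan q.1) := by
        rw [hp2, mul_one]
        nlinarith [Real.cos_sq_add_sin_sq (Real.arctan q.1)]

/-- `sin (arctan t) → 1` as `t → +∞`. [folklore] -/
theorem tendsto_sin_arctan_atTop :
    Tendsto (fun t : ℝ ↦ Real.sin (Real.arctan t)) atTop (𝓝 1) := by
  have h1 : Tendsto Real.arctan atTop (𝓝 (π / 2)) :=
    Real.tendsto_arctan_atTop.mono_right nhdsWithin_le_nhds
  have h2 := (Real.continuous_sin.tendsto (π / 2)).comp h1
  rwa [Real.sin_pi_div_two] at h2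

/-- `sin (arctan t) → -1` as `t → -∞`. [folklore] -/
theorem tendsto_sin_arctan_atBot :
    Tendsto (fun t : ℝ ↦ Real.sin (Real.arctan t)) atBot (𝓝 (-1)) := by
  have h1 : Tendsto Real.arctan atBot (𝓝 (-(π / 2))) :=
    Real.tendsto_arctan_atBot.mono_right nhdsWithin_le_nhds
  have h2 := (Real.continuous_sin.tendsto (-(π / 2))).comp h1
  rwa [Real.sin_neg, Real.sin_pi_div_two] at h2

/-- **The `+∞` end of the cylinder is mapped into any neighbourhood of the north pole**: for
`ε > 0` there is `T` with `dist (map n (t, p)) northPole < ε` for all `t ≥ T` and all `p`.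
[folklore] -/
theorem dist_map_northPole_lt {ε : ℝ} (hε : 0 < ε) :
    ∃ T : ℝ, ∀ q : ℝ × 𝕊 n, T ≤ q.1 → dist (map n q) (northPole n) < ε := by
  have ht : Tendsto (fun t : ℝ ↦ 2 - 2 * Real.sin (Real.arctan t)) atTop (𝓝 (2 - 2 * 1)) :=
    tendsto_const_nhds.sub (tendsto_const_nhds.mul (tendsto_sin_arctan_atTop))
  have hlt : (2 : ℝ) - 2 * 1 < ε ^ 2 := by nlinarith
  obtain ⟨T, hT⟩ := eventually_atTop.1 (ht.eventually_lt_const hlt)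
  refine ⟨T, fun q hq ↦ ?_⟩
  have hsq : dist (map n q) (northPole n) ^ 2 < ε ^ 2 := by
    rw [dist_map_northPole_sq]
    exact hT q.1 hq
  exact (pow_lt_pow_iff_left₀ dist_nonneg hε.le two_ne_zero).1 hsq

/-- **The `-∞` end of the cylinder is mapped into any neighbourhood of the south pole.**
[folklore] -/
theorem dist_map_southPole_lt {ε : ℝ} (hε : 0 < ε) :
    ∃ T : ℝ, ∀ q : ℝ × 𝕊 n, q.1 ≤ T → dist (map n q) (southPole n) < ε := by
  have ht : Tendsto (fun t : ℝ ↦ 2 + 2 * Real.sin (Real.arctan t)) atBot (𝓝 (2 + 2 * (-1))) :=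
    tendsto_const_nhds.add (tendsto_const_nhds.mul (tendsto_sin_arctan_atBot))
  have hlt : (2 : ℝ) + 2 * (-1) < ε ^ 2 := by nlinarith
  obtain ⟨T, hT⟩ := eventually_atBot.1 (ht.eventually_lt_const hlt)
  refine ⟨T, fun q hq ↦ ?_⟩
  have hsq : dist (map n q) (southPole n) ^ 2 < ε ^ 2 := by
    rw [dist_map_southPole_sq]
    exact hT q.1 hq
  exact (pow_lt_pow_iff_left₀ dist_nonneg hε.le two_ne_zero).1 hsq

/-- The poles are not in the image of `map n`. [folklore] -/
theorem map_ne_northPole (q : ℝ × 𝕊 n) : map n q ≠ northPole n := by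
  intro h
  have := init_coe_map_ne_zero n q
  rw [h] at this
  apply this
  ext j
  simp [northPole, init_apply, (Fin.castSucc_lt_last j).ne]

/-- The poles are not in the image of `map n`. [folklore] -/
theorem map_ne_southPole (q : ℝ × 𝕊 n) : map n q ≠ southPole n := by
  intro h
  have := init_coe_map_ne_zero n q
  rw [h] at this
  apply this
  ext j
  simp [southPole, init_apply, (Fin.castSucc_lt_last j).ne]

/-- Off the poles... a point of `Sⁿ⁺¹` with last coordinate of absolute value `< 1` — equivalently
not a pole — is in the image of `map n`: `z = map n (z_last / ‖z_init‖, z_init / ‖z_init‖)`.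
[folklore] -/
theorem exists_map_eq_of_init_ne_zero {z : 𝕊 (n + 1)} (hz : init n (z : 𝔼 (n + 1 + 1)) ≠ 0) :
    ∃ q : ℝ × 𝕊 n, map n q = z := by
  set r : ℝ := ‖init n (z : 𝔼 (n + 1 + 1))‖ with hr
  have hr0 : 0 < r := norm_pos_iff.2 hz
  set a : ℝ := (z : 𝔼 (n + 1 + 1)) (Fin.last (n + 1)) with ha
  -- `r ^ 2 + a ^ 2 = 1`
  have hsum : r ^ 2 + a ^ 2 = 1 := by
    have h1 : ‖(z : 𝔼 (n + 1 + 1))‖ ^ 2 = 1 := by rw [norm_eq_of_mem_sphere z, one_pow]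
    rw [EuclideanSpace.real_norm_sq_eq, Fin.sum_univ_castSucc] at h1
    rw [hr, EuclideanSpace.real_norm_sq_eq]
    simp only [init_apply]
    exact h1
  have hpmem : r⁻¹ • init n (z : 𝔼 (n + 1 + 1)) ∈ 𝕊 n := by
    rw [mem_sphere_zero_iff_norm, norm_smul, norm_inv, Real.norm_eq_abs, abs_of_pos hr0, ← hr,
      inv_mul_cancel₀ hr0.ne']
  -- the latitude of `z`: `cos θ = r`, `sin θ = a` for `θ = arctan (a / r)`
  have hcos : Real.cos (Real.arctan (a / r)) = r := by
    rw [Real.cos_arctan]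
    have : 1 + (a / r) ^ 2 = (1 / r) ^ 2 := by
      field_simp
      linarith [hsum]
    rw [this, Real.sqrt_sq (by positivity), one_div_one_div]
  have hsin : Real.sin (Real.arctan (a / r)) = a := by
    rw [← Real.tan_mul_cos (Real.cos_arctan_pos _).ne', Real.tan_arctan, hcos,
      div_mul_cancel₀ a hr0.ne']
  refine ⟨(a / r, ⟨r⁻¹ • init n (z : 𝔼 (n + 1 + 1)), hpmem⟩), ?_⟩
  apply Subtype.ext
  ext i
  induction i using Fin.lastCases with
  | last =>
    rw [coe_map, vec_apply_last]
    exact hsin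
  | cast j =>
    rw [coe_map, vec_apply_castSucc, hcos]
    change r * ((r⁻¹ • init n (z : 𝔼 (n + 1 + 1))) j) = (z : 𝔼 (n + 1 + 1)) (Fin.castSucc j)
    rw [PiLp.smul_apply, smul_eq_mul, init_apply, ← mul_assoc, mul_inv_cancel₀ hr0.ne', one_mul]

end CylinderToSphere

end Literature.Topology.FourManifolds

end
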